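import Summits.QuantumFields.BalabanUV.T4Continuum.Support.NE7K1LinSchurLineDerivRelWE
import Summits.QuantumFields.BalabanUV.T4Continuum.Support.NE7K1LinSchurConjEnergy
import Summits.QuantumFields.BalabanUV.T4Continuum.Support.NE7K1LinSchurSizes
import Summits.QuantumFields.BalabanUV.T4Continuum.Support.NE7K1LinRunBWeight
import Summits.QuantumFields.BalabanUV.T4Continuum.Support.NE7K1LinRunBScales
import Summits.QuantumFields.BalabanUV.T4Continuum.Support.NE7K1LinTwoRunLower
import Summits.QuantumFields.BalabanUV.T4Continuum.Support.NE7K1LinSchurLineDerivU1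

/-!
# NE7K1LinSchurLineDerivU1W — row NE7 (node U5), candidate route HOM, path H1L, cell K1-lin(s): **THE `η`-UNIFORM WEIGHTED `∂_s`
# LETTER OF THE TWO-CUTOFF LINE AT U = 1** — `‖e^{θ}((G(s) − G(t))g)‖ ≤ |t − s|·C·‖e^{θ}g‖` for every coarse weight `θ` with
# bond oscillation `≤ δ∕n` and block oscillation `≤ Θ` under the Combes–Thomas smallness, `C = C(d, L, a, δ, Θ)` free of the mesh
# `η = 1∕n` and of `s, t` — lens 1's (π6) CLOSED at U = 1

Lineage `b2b-balaban-t4-ne7-p2` (CRUX PROVER NE7 #2), generation 64; the assembly of (π6): abstract letter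
`NE7K1LinSchurLineDerivRelWE` ((i) energy form of Combes–Thomas, (ii) four-term form-relative bilinear errors) fed with
* `P₀ = runA`: coercive (`B4Lower18.lower18_zero`), energy form from `NE7K1LinFineOpWeight.conjError_fineOpR_ge`, bilinear error
  `NE7K1LinFineOpBilinWeight.bilin_conjError_fineOpR_le`;
* `P₁ = schur(runB) = twoCutoffLine 1`: coercive and energy form `NE7K1LinSchurConjEnergy` (conjugated Schur form ≥ ½ Schur form),
  bilinear error `NE7K1LinSchurBilinError.bilin_conjError_schur_le` with run B's bilinear error `NE7K1LinRunBWeight`, fluctuation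
  floor `d₀ = 2n²∕L^{d+1}` and coarse ceiling `a₀ = L²(4(d+1)n² + a)` (`NE7K1LinRunBScales`) — `a₀∕d₀ ≤ L^{d+3}(4(d+1)+a)∕2` and
  `1∕√d₀ ≤ √(L^{d+1}∕2)` are where the mesh cancels (`schur_bound_of_sizes`, abstract);
* comparability `c₁P₀ ≤ P₁ ≤ L²P₀` (`NE7K1LinTwoRunLower ∕ Upper`).
[folklore]:
* (kit `NE7K1LinSchurSizes`: `schur_bound_of_sizes`, the mesh-free constants `kappaH`, `schurConst`, `kappaU1W`);
* **`twoCutoff_inv_weighted_lipschitz`**: the displayed letter, `C = 4L²∕(c₁σ) + 2κ(8∕(c₁σ) + 8∕σ²)`, `σ = min(2,a)∕L^{d+1}`,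
  `c₁ = lowerConst`, under `2(d+1)δ² + a(e^Θ−1) ≤ σ∕2` and `L^{−(d+1)}(2(d+1)(δL)² + a(e^Θ−1))(L^{d+1}+1) ≤ σ∕2`.

HONEST FRAMING: [folklore] over the tree's `B4Lower18`; Gaussian (`A = 0`) two-cutoff comparison at ONE RG step in U = 1 gauge — an
INSTANCE of the K1-lin(s) mechanism, not Bałaban's (3.35) at general backgrounds (licence-gated `NE7K1LinSchurLineInst`); nothing
printed asserted; no `sorry`.  FIXED FINITE T⁴, rung (B)+1; NE7 NOT PRINTED ∕ NOT PROVED; spine 0∕9; NOT infinite volume, NOT mass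
gap, NOT Clay.  HONEST DEPENDENCY: continuum YM on T⁴ ⇐ BetaPertH ∧ nine spine estimates (0/9 proved); BetaPertH ⇐ (D1) ∧ (D4) ∧
CAP+tail; G-an2-4 gates asym, D1 and NE2/3/4.
-/

noncomputable section

open Finset Matrix

namespace Summit.QuantumFields.BalabanUV.T4Continuum.NE7K1LinSchurLineDerivU1W

open Literature.MathematicalPhysics.QuantumFieldTheory.Balaban1983to89
open Literature.MathematicalPhysics.QuantumFieldTheory.Balaban1983to89.B4Reflection242
open Literature.MathematicalPhysics.QuantumFieldTheory.Balaban1983to89.B4BoxCov237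
open Literature.MathematicalPhysics.QuantumFieldTheory.Balaban1983to89.B4Lower18
open NE7K1LinSchurLineForm NE7K1LinSchurLineCoords NE7K1LinFineOpWeight NE7K1LinBlockCoords NE7K1LinSchurLineU1
open NE7K1LinSchurLineDeriv NE7K1LinSchurLineDerivRel NE7K1LinConjW NE7K1LinFineOpBilinWeight NE7K1LinSchurHarmonicExt
open NE7K1LinSchurBilinError NE7K1LinSchurConjEnergy NE7K1LinSchurLineDerivRelWE NE7K1LinRunBWeight NE7K1LinRunBScales
open NE7K1LinTwoRunUpper NE7K1LinTwoRunLower NE7K1LinSchurLineDerivU1 NE7K1LinSchurSizes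

/-! ### The U = 1 two-cutoff line at a general coarse weight -/

section U1

variable {d : ℕ} {n L : ℕ} [NeZero L] {R' : Finset (Fin (d + 1) → ℤ)}

set_option maxHeartbeats 1600000 in
/-- **THE `η`-UNIFORM WEIGHTED `∂_s` LETTER OF THE TWO-CUTOFF LINE AT U = 1.**  For `a > 0`, `n ≥ 1`, `R′` a union of `nL`-blocks, a
coarse weight `θ` with `|θ x − θ y| ≤ δ∕n` across bonds (`0 ≤ δ ≤ 1`) and `≤ Θ` (`Θ ≥ 0`) inside `n`-blocks, under the two
Combes–Thomas smallness conditions (`σ = min(2,a)∕L^{d+1}`), and `s, t ∈ [0,1]`: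
`wN θ ((G(s) − G(t))g) ≤ (t − s)²·(4L²∕(c₁σ) + 2κ(8∕(c₁σ) + 8∕σ²))²·wN θ g`, `G(r) = (twoCutoffLine r)⁻¹`, `c₁ = lowerConst`,
`κ = kappaU1W d L a δ Θ` — NO `n` in the constant. [folklore] -/
theorem twoCutoff_inv_weighted_lipschitz (hn : 1 ≤ n) (hR' : IsBlockUnion (n * L) R') {a δ Θ : ℝ} (ha : 0 < a)
    (hδ0 : 0 ≤ δ) (hδ1 : δ ≤ 1) (hΘ0 : 0 ≤ Θ) (θ : ↥(R'.image (blk L)) → ℝ)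
    (hbond : ∀ x₁ x₂ : ↥(R'.image (blk L)), x₂.1 ∈ nbrs x₁.1 → |θ x₁ - θ x₂| ≤ δ * (1 / (n : ℝ)))
    (hblock : ∀ x₁ x₂ : ↥(R'.image (blk L)), blk n x₁.1 = blk n x₂.1 → |θ x₁ - θ x₂| ≤ Θ)
    (hsmallA : 2 * ((d : ℝ) + 1) * δ ^ 2 + a * (Real.exp Θ - 1) ≤ (min 2 a / (L : ℝ) ^ (d + 1)) / 2)
    (hsmallB : ((L : ℝ) ^ (d + 1))⁻¹ * (2 * ((d : ℝ) + 1) * (δ * L) ^ 2 + a * (Real.exp Θ - 1)) * ((L : ℝ) ^ (d + 1) + 1) ≤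
      (min 2 a / (L : ℝ) ^ (d + 1)) / 2)
    {s t : ℝ} (hs0 : 0 ≤ s) (hs1 : s ≤ 1) (ht0 : 0 ≤ t) (ht1 : t ≤ 1) (g : ↥(R'.image (blk L)) → ℝ) :
    wN θ (((twoCutoffLine (isBlockUnion_fine hR') n a s)⁻¹ - (twoCutoffLine (isBlockUnion_fine hR') n a t)⁻¹).mulVec g) ≤
      (t - s) ^ 2 * (4 * (L : ℝ) ^ 2 / (((6 * ((d : ℝ) + 1) * (L : ℝ) ^ 2 + 6) * (L : ℝ) ^ (d + 1) / (2 * (L : ℝ) ^ 2))⁻¹ *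
        (min 2 a / (L : ℝ) ^ (d + 1))) + 2 * kappaU1W d L a δ Θ * (8 / (((6 * ((d : ℝ) + 1) * (L : ℝ) ^ 2 + 6) * (L : ℝ) ^ (d + 1) / (2 * (L : ℝ) ^ 2))⁻¹ *
          (min 2 a / (L : ℝ) ^ (d + 1))) + 8 / (min 2 a / (L : ℝ) ^ (d + 1)) ^ 2)) ^ 2 *
        wN θ g := by
  classical
  have hL : 1 ≤ L := NeZero.one_le
  have hR'L : IsBlockUnion L R' := isBlockUnion_fine hR'
  have hRc : IsBlockUnion n (R'.image (blk L)) := isBlockUnion_coarse hL hR'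
  have hn0 : (0 : ℝ) < n := by exact_mod_cast hn
  have hn1 : (1 : ℝ) ≤ n := by exact_mod_cast hn
  have hL0 : (0 : ℝ) < L := by exact_mod_cast hL
  have hL1 : (1 : ℝ) ≤ L := by exact_mod_cast hL
  have hLpow : (0 : ℝ) < (L : ℝ) ^ (d + 1) := by positivity
  have hLpow1 : (1 : ℝ) ≤ (L : ℝ) ^ (d + 1) := one_le_pow₀ hL1
  have hmin : 0 < min 2 a := lt_min (by norm_num) ha
  have hexp : 0 ≤ Real.exp Θ - 1 := by linarith [Real.add_one_le_exp Θ]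
  set σ : ℝ := min 2 a / (L : ℝ) ^ (d + 1) with hσ
  have hσ0 : 0 < σ := div_pos hmin hLpow
  have hσle : σ ≤ min 2 a := div_le_self hmin.le hLpow1
  set c₁ : ℝ := ((6 * ((d : ℝ) + 1) * (L : ℝ) ^ 2 + 6) * (L : ℝ) ^ (d + 1) / (2 * (L : ℝ) ^ 2))⁻¹ with hc₁
  have hc₁pos : 0 < c₁ := lowerConst_pos d L
  have hc₁le : c₁ ≤ 1 := lowerConst_le_one d L
  set H := runB hR'L n a with hH
  set P₀ := runA n L a R' with hP₀def
  set P₁ := schur H with hP₁def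
  have hP₁eq : twoCutoffLine hR'L n a 1 = P₁ := by rw [twoCutoffLine_one]; rfl
  set ρ : ↥(R'.image (blk L)) ⊕ (↥(R'.image (blk L)) × NZ d L) → ℝ := fun c => θ (site c) with hρ
  have hρinl : ρ ∘ Sum.inl = θ := rfl
  have nn : ∀ v : ↥(R'.image (blk L)) → ℝ, 0 ≤ v ⬝ᵥ v := fun v => by
    simp only [dotProduct]; exact Finset.sum_nonneg fun _ _ => mul_self_nonneg _
  have nn' : ∀ v : ↥(R'.image (blk L)) ⊕ (↥(R'.image (blk L)) × NZ d L) → ℝ, 0 ≤ v ⬝ᵥ v := fun v => by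
    simp only [dotProduct]; exact Finset.sum_nonneg fun _ _ => mul_self_nonneg _
  -- (1) coercivity of the two members and of run B
  have hP₀ : ∀ v, σ * (v ⬝ᵥ v) ≤ v ⬝ᵥ P₀.mulVec v := fun v =>
    (mul_le_mul_of_nonneg_right hσle (nn v)).trans (lower18_zero hn ha.le hRc v)
  have hHB : ∀ v, σ * (v ⬝ᵥ v) ≤ v ⬝ᵥ H.mulVec v := fun v => runB_coercive hn hR' ha.le v
  have hP₁ : ∀ v, σ * (v ⬝ᵥ v) ≤ v ⬝ᵥ P₁.mulVec v := schur_coercive H hσ0 hHB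
  -- (2) energy forms of Combes–Thomas
  have hδn : δ * (1 / (n : ℝ)) ≤ 1 := by
    calc δ * (1 / (n : ℝ)) ≤ 1 * 1 := mul_le_mul hδ1 (by rw [div_le_one hn0]; exact hn1) (by positivity) zero_le_one
      _ = 1 := one_mul 1
  have herrA : ∀ w, -(σ / 2) * (w ⬝ᵥ w) ≤ w ⬝ᵥ (conjW θ P₀).mulVec w - w ⬝ᵥ P₀.mulVec w := by
    intro w
    rw [form_conjW_sub_eq]
    have h := conjError_fineOpR_ge hn hRc ha.le hδn hΘ0 θ hbond hblock w
    exact (mul_le_mul_of_nonneg_right (neg_le_neg hsmallA) (nn w)).trans h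
  have hE₀ : ∀ w, (w ⬝ᵥ P₀.mulVec w) / 2 ≤ w ⬝ᵥ (conjW θ P₀).mulVec w := fun w => (coercive_conjW θ P₀ hP₀ herrA w).2
  have herrB : ∀ v, -(σ / 2) * (v ⬝ᵥ v) ≤ v ⬝ᵥ (conjW ρ H).mulVec v - v ⬝ᵥ H.mulVec v := by
    intro v
    have h := runB_conjError_ge hn hR' ha.le hδ0 hδ1 hΘ0 θ hbond hblock v
    exact (mul_le_mul_of_nonneg_right (neg_le_neg hsmallB) (nn' v)).trans h
  have hHs : H.IsSymm := runB_isSymm hR'L n a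
  have hE₁ : ∀ w, (w ⬝ᵥ P₁.mulVec w) / 2 ≤ w ⬝ᵥ (conjW θ P₁).mulVec w := fun w => by
    have h := schur_conj_form_ge H hHs ρ hσ0 hHB herrB w
    rwa [hρinl] at h
  -- (3) comparability
  have hP₀nn : ∀ v, 0 ≤ v ⬝ᵥ P₀.mulVec v := fun v => le_trans (mul_nonneg hσ0.le (nn v)) (hP₀ v)
  have hlow : ∀ v, c₁ * (v ⬝ᵥ P₀.mulVec v) ≤ v ⬝ᵥ P₁.mulVec v := fun v => by
    have h := runA_form_le_schurB hn hR' ha v; rwa [hP₁eq] at h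
  have hup' : ∀ v, v ⬝ᵥ P₁.mulVec v ≤ (L : ℝ) ^ 2 * (v ⬝ᵥ P₀.mulVec v) := fun v => by
    have h := schurB_form_le hn hR' ha v; rwa [hP₁eq] at h
  have hL2 : (1 : ℝ) ≤ (L : ℝ) ^ 2 := one_le_pow₀ hL1
  have hup : ∀ v, v ⬝ᵥ P₁.mulVec v - v ⬝ᵥ P₀.mulVec v ≤ (L : ℝ) ^ 2 * (v ⬝ᵥ P₀.mulVec v) := fun v => by
    have h1 := hup' v; have h2 := hP₀nn v; linarith
  have hlo : ∀ v, v ⬝ᵥ P₀.mulVec v - v ⬝ᵥ P₁.mulVec v ≤ (L : ℝ) ^ 2 * (v ⬝ᵥ P₀.mulVec v) := fun v => by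
    have h1 := hlow v; have h2 := hP₀nn v
    have h3 : 0 ≤ c₁ * (v ⬝ᵥ P₀.mulVec v) := mul_nonneg hc₁pos.le h2
    have h4 : v ⬝ᵥ P₀.mulVec v ≤ (L : ℝ) ^ 2 * (v ⬝ᵥ P₀.mulVec v) := le_mul_of_one_le_left h2 hL2
    linarith
  -- (4) the bilinear errors
  set κ := kappaU1W d L a δ Θ with hκdef
  have hκ0 : 0 ≤ κ := kappaU1W_nonneg d L ha.le hΘ0
  -- (4a) run A
  have hb₀ : ∀ z u, |z ⬝ᵥ (conjW θ P₀).mulVec u - z ⬝ᵥ P₀.mulVec u| ≤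
      κ * (Real.sqrt (z ⬝ᵥ P₀.mulVec z) * Real.sqrt (u ⬝ᵥ u) + Real.sqrt (z ⬝ᵥ z) * Real.sqrt (u ⬝ᵥ P₀.mulVec u) +
        Real.sqrt (z ⬝ᵥ z) * Real.sqrt (u ⬝ᵥ u) + Real.sqrt (z ⬝ᵥ P₀.mulVec z) * Real.sqrt (u ⬝ᵥ P₀.mulVec u)) := by
    intro z u
    have h := bilin_conjError_fineOpR_le hn hRc ha.le hδn hΘ0 θ hbond hblock z u
    rw [show fineOpR n a 0 (R'.image (blk L)) = P₀ from rfl] at h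
    refine h.trans ?_
    set Z := Real.sqrt (z ⬝ᵥ P₀.mulVec z); set U := Real.sqrt (u ⬝ᵥ P₀.mulVec u)
    set Nz := Real.sqrt (z ⬝ᵥ z); set Nu := Real.sqrt (u ⬝ᵥ u)
    have hZ : 0 ≤ Z := Real.sqrt_nonneg _
    have hU : 0 ≤ U := Real.sqrt_nonneg _
    have hNz : 0 ≤ Nz := Real.sqrt_nonneg _
    have hNu : 0 ≤ Nu := Real.sqrt_nonneg _
    have hS0 := schurConst_nonneg d L ha.le hΘ0 (δ := δ)
    have hB0 : 0 ≤ 2 * ((d : ℝ) + 1) * δ ^ 2 + a * (Real.exp Θ - 1) := by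
      have h1 : 0 ≤ 2 * ((d : ℝ) + 1) * δ ^ 2 := by positivity
      linarith [mul_nonneg ha.le hexp]
    have hR0 := Real.sqrt_nonneg (2 * (2 * ((d : ℝ) + 1) * δ ^ 2))
    have hk1 : Real.sqrt (2 * (2 * ((d : ℝ) + 1) * δ ^ 2)) ≤ κ := by rw [hκdef, kappaU1W]; linarith
    have hk2 : 2 * ((d : ℝ) + 1) * δ ^ 2 + a * (Real.exp Θ - 1) ≤ κ := by rw [hκdef, kappaU1W]; linarith
    have t1 := mul_le_mul_of_nonneg_right hk1 (mul_nonneg hNz hU)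
    have t2 := mul_le_mul_of_nonneg_right hk1 (mul_nonneg hNu hZ)
    have t3 := mul_le_mul_of_nonneg_right hk2 (mul_nonneg hNz hNu)
    have t4 : 0 ≤ κ * (Z * U) := mul_nonneg hκ0 (mul_nonneg hZ hU)
    have e1 : Real.sqrt (2 * (2 * ((d : ℝ) + 1) * δ ^ 2)) * (Nz * U + Nu * Z) +
        (2 * ((d : ℝ) + 1) * δ ^ 2 + a * (Real.exp Θ - 1)) * (Nz * Nu) =
        Real.sqrt (2 * (2 * ((d : ℝ) + 1) * δ ^ 2)) * (Nz * U) + Real.sqrt (2 * (2 * ((d : ℝ) + 1) * δ ^ 2)) * (Nu * Z) +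
          (2 * ((d : ℝ) + 1) * δ ^ 2 + a * (Real.exp Θ - 1)) * (Nz * Nu) := by ring
    have e2 : κ * (Z * Nu + Nz * U + Nz * Nu + Z * U) = κ * (Nz * U) + κ * (Nu * Z) + κ * (Nz * Nu) + κ * (Z * U) := by ring
    rw [e1, e2]
    linarith
  -- (4b) run B's bilinear error with one constant
  set κH := kappaH d L a δ Θ with hκHdef
  have hκH0 : 0 ≤ κH := kappaH_nonneg d L ha.le hΘ0
  have hbH : ∀ v v', |v ⬝ᵥ (conjW ρ H).mulVec v' - v ⬝ᵥ H.mulVec v'| ≤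
      κH * (Real.sqrt (v ⬝ᵥ H.mulVec v) * Real.sqrt (v' ⬝ᵥ v') + Real.sqrt (v ⬝ᵥ v) * Real.sqrt (v' ⬝ᵥ H.mulVec v') +
        Real.sqrt (v ⬝ᵥ v) * Real.sqrt (v' ⬝ᵥ v')) := by
    intro v v'
    have h := runB_bilinError_le hn hR' ha.le hδ0 hδ1 hΘ0 θ hbond hblock v v'
    refine h.trans ?_
    set A := Real.sqrt (v ⬝ᵥ H.mulVec v); set A' := Real.sqrt (v' ⬝ᵥ H.mulVec v')
    set N := Real.sqrt (v ⬝ᵥ v); set N' := Real.sqrt (v' ⬝ᵥ v')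
    have hA : 0 ≤ A := Real.sqrt_nonneg _
    have hA' : 0 ≤ A' := Real.sqrt_nonneg _
    have hN : 0 ≤ N := Real.sqrt_nonneg _
    have hN' : 0 ≤ N' := Real.sqrt_nonneg _
    have hk' : ((L : ℝ) ^ (d + 1))⁻¹ * Real.sqrt (2 * (2 * ((d : ℝ) + 1) * (δ * L) ^ 2)) * Real.sqrt ((L : ℝ) ^ (d + 1) + 1) *
        Real.sqrt ((L : ℝ) ^ (d + 1)) ≤ κH := by
      rw [hκHdef, kappaH]
      have h1 : 0 ≤ 2 * ((d : ℝ) + 1) * (δ * L) ^ 2 := by positivity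
      have h2 : 0 ≤ 2 * ((d : ℝ) + 1) * (δ * L) ^ 2 + a * (Real.exp Θ - 1) := by linarith [mul_nonneg ha.le hexp]
      have : 0 ≤ ((L : ℝ) ^ (d + 1))⁻¹ * (2 * ((d : ℝ) + 1) * (δ * L) ^ 2 + a * (Real.exp Θ - 1)) * ((L : ℝ) ^ (d + 1) + 1) := by
        have := hLpow.le; positivity
      linarith
    have hk'' : ((L : ℝ) ^ (d + 1))⁻¹ * (2 * ((d : ℝ) + 1) * (δ * L) ^ 2 + a * (Real.exp Θ - 1)) * ((L : ℝ) ^ (d + 1) + 1) ≤ κH := by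
      rw [hκHdef, kappaH]
      have : 0 ≤ ((L : ℝ) ^ (d + 1))⁻¹ * Real.sqrt (2 * (2 * ((d : ℝ) + 1) * (δ * L) ^ 2)) * Real.sqrt ((L : ℝ) ^ (d + 1) + 1) *
          Real.sqrt ((L : ℝ) ^ (d + 1)) := by positivity
      linarith
    have t1 := mul_le_mul_of_nonneg_right hk' (add_nonneg (mul_nonneg hN hA') (mul_nonneg hN' hA))
    have t2 := mul_le_mul_of_nonneg_right hk'' (mul_nonneg hN hN')
    have e2 : κH * (A * N' + N * A' + N * N') = κH * (N * A' + N' * A) + κH * (N * N') := by ring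
    rw [e2]
    exact add_le_add t1 t2
  -- (4c) the Schur member: sizes
  set d₀ : ℝ := 2 * (n : ℝ) ^ 2 / (L : ℝ) ^ (d + 1) with hd₀
  have hd₀pos : 0 < d₀ := by positivity
  set a₀ : ℝ := (L : ℝ) ^ 2 * (4 * ((d : ℝ) + 1) * (n : ℝ) ^ 2 + a) with ha₀
  have ha₀0 : 0 ≤ a₀ := by positivity
  have hd : ∀ ψ : ↥(R'.image (blk L)) × NZ d L → ℝ, d₀ * (ψ ⬝ᵥ ψ) ≤ Sum.elim 0 ψ ⬝ᵥ H.mulVec (Sum.elim 0 ψ) :=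
    fun ψ => runB_fluct_floor hn hR' ha.le ψ
  have haC : ∀ z : ↥(R'.image (blk L)) → ℝ, Sum.elim z 0 ⬝ᵥ H.mulVec (Sum.elim z 0) ≤ a₀ * (z ⬝ᵥ z) := fun z => by
    refine (trial_form_le hn hR' ha.le z).trans ?_
    rw [ha₀, mul_assoc]
    exact mul_le_mul_of_nonneg_left (runA_form_le_norm hn hRc ha.le z) (by positivity)
  set e : ℝ := Real.sqrt (1 + (L : ℝ) ^ (d + 3) * (4 * ((d : ℝ) + 1) + a) / 2) with hedef
  set q : ℝ := Real.sqrt ((L : ℝ) ^ (d + 1) / 2) with hqdef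
  have he : Real.sqrt (1 + a₀ / d₀) ≤ e := by
    have hmain : a₀ / d₀ ≤ (L : ℝ) ^ (d + 3) * (4 * ((d : ℝ) + 1) + a) / 2 := by
      rw [div_le_iff₀ hd₀pos, ha₀, hd₀]
      have hn2 : (1 : ℝ) ≤ (n : ℝ) ^ 2 := one_le_pow₀ hn1
      have e1 : (L : ℝ) ^ (d + 3) * (4 * ((d : ℝ) + 1) + a) / 2 * (2 * (n : ℝ) ^ 2 / (L : ℝ) ^ (d + 1)) =
          (L : ℝ) ^ 2 * (4 * ((d : ℝ) + 1) * (n : ℝ) ^ 2 + a * (n : ℝ) ^ 2) := by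
        field_simp
        ring
      rw [e1]
      have h3 : 0 ≤ (L : ℝ) ^ 2 * (a * ((n : ℝ) ^ 2 - 1)) := mul_nonneg (sq_nonneg _) (mul_nonneg ha.le (sub_nonneg.2 hn2))
      have e2 : (L : ℝ) ^ 2 * (4 * ((d : ℝ) + 1) * (n : ℝ) ^ 2 + a * (n : ℝ) ^ 2) =
          (L : ℝ) ^ 2 * (4 * ((d : ℝ) + 1) * (n : ℝ) ^ 2 + a) + (L : ℝ) ^ 2 * (a * ((n : ℝ) ^ 2 - 1)) := by ring
      rw [e2]
      linarith
    rw [hedef]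
    exact Real.sqrt_le_sqrt (by linarith)
  have hq : 1 / Real.sqrt d₀ ≤ q := by
    rw [div_le_iff₀ (Real.sqrt_pos.2 hd₀pos), hqdef, ← Real.sqrt_mul (by positivity)]
    have e1 : (L : ℝ) ^ (d + 1) / 2 * d₀ = (n : ℝ) ^ 2 := by rw [hd₀]; field_simp
    rw [e1, Real.sqrt_sq hn0.le]
    exact hn1
  have hSch := fun z u => schur_bound_of_sizes H hHs ρ hσ0 hκH0 hd₀pos hHB herrB hbH hd ha₀0 haC he hq z u
  -- (4d) the Schur member in `P₀`'s currency
  have hb₁ : ∀ z u, |z ⬝ᵥ (conjW θ P₁).mulVec u - z ⬝ᵥ P₁.mulVec u| ≤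
      κ * (Real.sqrt (z ⬝ᵥ P₀.mulVec z) * Real.sqrt (u ⬝ᵥ u) + Real.sqrt (z ⬝ᵥ z) * Real.sqrt (u ⬝ᵥ P₀.mulVec u) +
        Real.sqrt (z ⬝ᵥ z) * Real.sqrt (u ⬝ᵥ u) + Real.sqrt (z ⬝ᵥ P₀.mulVec z) * Real.sqrt (u ⬝ᵥ P₀.mulVec u)) := by
    intro z u
    have h := hSch z u
    rw [hρinl] at h
    refine h.trans ?_
    set Z := Real.sqrt (z ⬝ᵥ P₀.mulVec z); set U := Real.sqrt (u ⬝ᵥ P₀.mulVec u)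
    set Nz := Real.sqrt (z ⬝ᵥ z); set Nu := Real.sqrt (u ⬝ᵥ u)
    have hZ : 0 ≤ Z := Real.sqrt_nonneg _
    have hU : 0 ≤ U := Real.sqrt_nonneg _
    have hNz : 0 ≤ Nz := Real.sqrt_nonneg _
    have hNu : 0 ≤ Nu := Real.sqrt_nonneg _
    -- `√E_S ≤ L√E₀`
    have hSz : Real.sqrt (z ⬝ᵥ (schur H).mulVec z) ≤ (L : ℝ) * Z := by
      rw [← Real.sqrt_sq hL0.le, ← Real.sqrt_mul (sq_nonneg _)]
      exact Real.sqrt_le_sqrt (hup' z)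
    have hSu : Real.sqrt (u ⬝ᵥ (schur H).mulVec u) ≤ (L : ℝ) * U := by
      rw [← Real.sqrt_sq hL0.le, ← Real.sqrt_mul (sq_nonneg _)]
      exact Real.sqrt_le_sqrt (hup' u)
    have hC0 : 0 ≤ κH * ((e + 2 * κH * ((1 + q) * e + q) * q) + e * (1 + 2 * κH * ((1 + q) * e + q)) +
        e * (e + 2 * κH * ((1 + q) * e + q) * q)) := by positivity
    have hprod : (Real.sqrt (z ⬝ᵥ (schur H).mulVec z) + Nz) * (Real.sqrt (u ⬝ᵥ (schur H).mulVec u) + Nu) ≤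
        ((L : ℝ) * Z + Nz) * ((L : ℝ) * U + Nu) :=
      mul_le_mul (add_le_add hSz le_rfl) (add_le_add hSu le_rfl) (by positivity) (by positivity)
    have hL4 : ((L : ℝ) * Z + Nz) * ((L : ℝ) * U + Nu) ≤ (L : ℝ) ^ 2 * (Z * Nu + Nz * U + Nz * Nu + Z * U) := by
      have hLL : (L : ℝ) ≤ (L : ℝ) ^ 2 := by nlinarith
      have a1 : (L : ℝ) * (Z * Nu) ≤ (L : ℝ) ^ 2 * (Z * Nu) := mul_le_mul_of_nonneg_right hLL (mul_nonneg hZ hNu)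
      have a2 : (L : ℝ) * (Nz * U) ≤ (L : ℝ) ^ 2 * (Nz * U) := mul_le_mul_of_nonneg_right hLL (mul_nonneg hNz hU)
      have a3 : Nz * Nu ≤ (L : ℝ) ^ 2 * (Nz * Nu) := le_mul_of_one_le_left (mul_nonneg hNz hNu) hL2
      have e3 : ((L : ℝ) * Z + Nz) * ((L : ℝ) * U + Nu) =
          (L : ℝ) ^ 2 * (Z * U) + (L : ℝ) * (Z * Nu) + (L : ℝ) * (Nz * U) + Nz * Nu := by ring
      have e4 : (L : ℝ) ^ 2 * (Z * Nu + Nz * U + Nz * Nu + Z * U) =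
          (L : ℝ) ^ 2 * (Z * U) + (L : ℝ) ^ 2 * (Z * Nu) + (L : ℝ) ^ 2 * (Nz * U) + (L : ℝ) ^ 2 * (Nz * Nu) := by ring
      rw [e3, e4]
      linarith
    have hCκ : κH * ((e + 2 * κH * ((1 + q) * e + q) * q) + e * (1 + 2 * κH * ((1 + q) * e + q)) +
        e * (e + 2 * κH * ((1 + q) * e + q) * q)) * (L : ℝ) ^ 2 ≤ κ := by
      have h1 : κH * ((e + 2 * κH * ((1 + q) * e + q) * q) + e * (1 + 2 * κH * ((1 + q) * e + q)) +
          e * (e + 2 * κH * ((1 + q) * e + q) * q)) * (L : ℝ) ^ 2 = schurConst d L a δ Θ := by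
        rw [schurConst, hκHdef, hedef, hqdef]
      rw [h1, hκdef, kappaU1W]
      have h2 : 0 ≤ 2 * ((d : ℝ) + 1) * δ ^ 2 := by positivity
      have h3 := mul_nonneg ha.le hexp
      have h5 := Real.sqrt_nonneg (2 * (2 * ((d : ℝ) + 1) * δ ^ 2))
      linarith
    have h4 : 0 ≤ Z * Nu + Nz * U + Nz * Nu + Z * U :=
      add_nonneg (add_nonneg (add_nonneg (mul_nonneg hZ hNu) (mul_nonneg hNz hU)) (mul_nonneg hNz hNu)) (mul_nonneg hZ hU)
    calc κH * ((e + 2 * κH * ((1 + q) * e + q) * q) + e * (1 + 2 * κH * ((1 + q) * e + q)) +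
          e * (e + 2 * κH * ((1 + q) * e + q) * q)) *
          ((Real.sqrt (z ⬝ᵥ (schur H).mulVec z) + Nz) * (Real.sqrt (u ⬝ᵥ (schur H).mulVec u) + Nu))
        ≤ κH * ((e + 2 * κH * ((1 + q) * e + q) * q) + e * (1 + 2 * κH * ((1 + q) * e + q)) +
          e * (e + 2 * κH * ((1 + q) * e + q) * q)) * ((L : ℝ) ^ 2 * (Z * Nu + Nz * U + Nz * Nu + Z * U)) :=
          mul_le_mul_of_nonneg_left (hprod.trans hL4) hC0
      _ = (κH * ((e + 2 * κH * ((1 + q) * e + q) * q) + e * (1 + 2 * κH * ((1 + q) * e + q)) +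
          e * (e + 2 * κH * ((1 + q) * e + q) * q)) * (L : ℝ) ^ 2) * (Z * Nu + Nz * U + Nz * Nu + Z * U) := by ring
      _ ≤ κ * (Z * Nu + Nz * U + Nz * Nu + Z * U) := mul_le_mul_of_nonneg_right hCκ h4
  -- (5) assemble
  have main := wN_inv_line_sub_inv_line_leE θ P₀ P₁ (fineOpR_isSymm n a 0 _) (schur_isSymm H hHs) hσ0 hc₁pos hc₁le
    (by positivity : (0 : ℝ) < (L : ℝ) ^ 2) hκ0 hP₀ hP₁ hE₀ hE₁ hlow hup hlo hb₀ hb₁ hs0 hs1 ht0 ht1 g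
  exact main

end U1

end Summit.QuantumFields.BalabanUV.T4Continuum.NE7K1LinSchurLineDerivU1W
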